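/-
Copyright: the b2b-balaban T⁴-continuum CRUX team, row NE7b owner lineage `t4-ne7b-p1` (gen 116). Project licence.
-/
import Summits.QuantumFields.BalabanUV.T4Continuum.Spine.NE7b.SupSmallFieldBackground

/-!
# THE INTERACTING BACKGROUND IS A SEMIGROUP IN THE BLOCK SIDE — `k` steps of side `L` ARE one step of side `L^k`: on `ℓ^∞(ℤ^d)`,
# for sides `(m+1)·(k+1) = n+1`, a solution of (60)'s side-`(n+1)` background system for the potential `u` SOLVES the side-`(m+1)`
# system for the CANONICALLY RESCALED potential `(k+1)⁻²·u` with coarse datum its own `(m+1)`-block average, hence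
# `σ_{n+1}[u] = σ_{m+1}[(k+1)⁻²u] ∘ (Q′_{m+1} ∘ σ_{n+1}[u])` on the chart ball, and the intermediate map `Q′_{m+1} ∘ σ_{n+1}[u]` is a
# `(N⁻¹ − c)⁻¹`-Lipschitz section of `Q′_{k+1}` — the tower's composite transport has (60)'s ONE-STEP letters IN CLOSED FORM, no product
# (row NE7b, node U5c; (60) BY NAME + block nesting; [folklore])

Cell `pub-balaban`, sub-cell `t4`, spine estimate NE7b (`T4WeightBudget.RelWeightBound`; the cell's OWN estimate — NOT PRINTED in
[Bałaban 1983–89], NOT PROVED).  Crux-route work under `Spine/NE7b/` by the row OWNER (`t4-ne7b-p1` gen 116) under FREEZE (0)'s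
crux-prover clause (FILING-CLAIM C-ne7bp1-g116-2); NOTHING of Bałaban's is named, valued or asserted; no `T4Continuum/Support` leaf
typed; no `def`, no notation; zero `sorry`.  Imports (BY NAME): the owner's (60) `…SupSmallFieldBackground` (`exists_background`; through
it leaf-06's (57) `…AugmentedSupEquivalence.exists_clm_blockAvg` and the Literature columns `B6QGQLower276` (`blk`, `B`, `AX`, `lapKer`,
`sameBlk`), `B5Hk103ScalarZd` (`nbhd`, `tsum_AX_mul`, `tsum_lapKer_mul`)).

WHY (located).  Print ITERATES averaging steps of side `L` and reads every `k`-step object as the ONE-step object of the composite side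
`L^k` ([B5] (1.16) `Q′_m∘Q′_n = Q′_{mn}`; the backgrounds of [B15]∕[B16] are minimisers under the composite constraint).  On the sup road
the equation-map tower (leaf-06's SET ∕ SOS, leaf-04's STG ∕ `…SupEquationTowerSemigroup`) proves the identification ABSTRACTLY —
given charts at every level — and books the composite section's letter as the DISPLAYED PRODUCT `∏_{j<k}(N_j⁻¹ − c_j)⁻¹` with shrinking
radii (PRICING-NE7b F784 ∕ F793: «no control»); leaf-05's `…BlockAverageSemigroup` does the FREE scalar flow on the torus.  For the
interacting skeleton of (60) the control is elementary and needs no chart beyond (60)'s own: (i) blocks nest, `blk_k(blk_m p) =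
blk_n p` (§1), so a field constant on `(n+1)`-blocks is constant on `(m+1)`-blocks and `Q′_k∘Q′_m = Q′_n`; (ii) the site matrix is
`A_n = (n+1)²(−Δ) + a·Q′_n*Q′_n` (§2 `sum_nbhd_AX_mul`), and `(n+1)² = (m+1)²(k+1)²`, so for ANY field `φ`:
`A_mφ + (k+1)⁻²u∘φ = (k+1)⁻²(A_nφ + u∘φ) − (k+1)⁻²a·(Q′_nφ)∘blk_n + a·(Q′_mφ)∘blk_m` — if `A_nφ + u∘φ` is `(n+1)`-block-constant, the
right side is `(m+1)`-block-constant (§3 `background_eq_descends`: THE CANONICAL RESCALING OF THE POTENTIAL, `u ↦ (k+1)⁻²u`, made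
explicit); (iii) (60)'s uniqueness clause at side `m+1` (radius `r∕(N⁻¹ − c) ≥ r`, potential `(k+1)⁻²u`, whose letters `λ, L` only
improve) identifies `σ_{n+1}[u](w)` with `σ_{m+1}[(k+1)⁻²u](Q′_{m+1}(σ_{n+1}[u](w)))` (§4).  Consequently every composite transport of the
interacting sup tower IS a one-shot background of (60) and carries (60)'s ∕ (63)'s ∕ (75)'s side-uniform letters verbatim: the same
Lipschitz constant `(N⁻¹ − c)⁻¹`, the same chart ball `(N⁻¹ − c)·r`, at every depth — the closed form the pricing desk asked for, for
this model.  HONEST: the rescaling `(k+1)⁻²` says the sitewise term is RELEVANT with exponent 2 in (60)'s normalisation (a bounded-`u′`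
term scales like a mass); anchoring the potential at the coarsest level, all finer levels carry SMALLER constants, so (60)'s hypotheses
`(λ, L, c, N)` hold along the whole tower with the top level's values.

WHAT IS PROVED ([folklore]; `ℓ^∞ := lp (fun _ : X d => ℝ) ∞`; sides `n + 1 = (m+1)(k+1)`):
* §1 `side_mul`, **`blk_blk`** (`blk k (blk m p) = blk n p`), `B_eq_biUnion`, `sum_B_eq_sum_sum` (`Σ_{B_n y} = Σ_{z∈B_k y} Σ_{B_m z}`),
  `blockAvg_blockAvg` (`Q′_k(Q′_m f) = Q′_n f` sitewise), `sum_B_comp_blk` ∕ `blockAvg_comp_blk` (block means of block-constant fields),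
  `blockConst_descends` (constant on `(n+1)`-blocks ⟹ constant on `(m+1)`-blocks).
* §2 **`sum_nbhd_AX_mul`** — THE ROW FORMULA `Σ_{r∈nbhd_n p} A_n(p,r)f(r) = (n+1)²Σ_μ(2f(p) − f(p+e_μ) − f(p−e_μ)) + a(n+1)^{−d}Σ_{B_n(blk_n p)} f`
  (every `d`, every `f : ℤ^d → ℝ`).
* §3 **`background_eq_descends`** — sitewise, any `a`, `u`, `φ`: the side-`(n+1)` background system for `u` implies the side-`(m+1)`
  system for `(k+1)⁻²·u`.
* §4 **`exists_background_semigroup`** — `d ≥ 3`, `a > 0`, (60)'s data `(u, u′, λ, L, c, N, r)`: `∃` (60)'s operators and background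
  `σ_n` at side `n+1` (potential `u`, radius `r`) WITH ALL OF (60)'s LETTERS, (60)'s operators and background `σ_m` at side `m+1`
  (potential `(k+1)⁻²u`, radius `r∕(N⁻¹ − c)`) WITH ALL OF (60)'s LETTERS, the block average `Q′_k`, such that `Q′_k∘Q′_m = Q′_n` and on
  `‖w‖ ≤ (N⁻¹ − c)r`: `Q′_m(σ_n w) ∈ closedBall 0 r`, `Q′_k(Q′_m(σ_n w)) = w`, `σ_n w` solves the side-`(m+1)` system for `(k+1)⁻²u`, and
  **`σ_m(Q′_m(σ_n w)) = σ_n w`**; and `w ↦ Q′_m(σ_n w)` is `(N⁻¹ − c)⁻¹`-Lipschitz there — THE STEP BRANCH OF THE INTERACTING TOWER WITH THE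
  ONE-STEP CONSTANT.
* §5 toy (`example`): sides `2·2 = 4`, the rescaling factor `(k+1)⁻² = 1∕4`.

HONEST (what this is NOT).  Two levels (the ℕ-indexed tower is the induction `(L^j, L) ↦ L^{j+1}` over §4 — bookkeeping, left to the
consumer ∕ SET's `tower_eq_const`); no derivative-level chain rule `Dσ_n = Dσ_m∘Q′_m∘Dσ_n` typed (it follows from §4 on the open ball by
uniqueness of derivatives — not here); the intermediate level's own effective equation (what `Q′_m∘σ_n` solves as a level-`k` background
of the EFFECTIVE action) is not displayed — only its section ∕ Lipschitz letters; scalar `ℤ^d` skeleton, hard constraint, sitewise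
interaction; nothing of the covariant `H_k`, (A3) ∕ (A1c) (NC-NE7b-α UNRULED).  BY-NAME EFFECT ON THE WALL: NONE.  NE7b NOT PRINTED ∕ NOT
PROVED; spine PROVED 0∕9; rung (B)+1 on a FINITE torus — NOT infinite volume, NOT the mass gap, NOT Clay.  HONEST DEPENDENCY: continuum
YM on T⁴ ⇐ BetaPertH ∧ nine spine estimates (0∕9 proved); BetaPertH ⇐ (D1) ∧ (D4) ∧ CAP+tail; G-an2-4 gates asym, D1 and NE2∕3∕4.
-/

set_option autoImplicit false

noncomputable section

namespace Summit.QuantumFields.BalabanUV.T4Continuum.NE7b.SupBackgroundSemigroup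

open scoped ENNReal NNReal
open Metric Set
open Literature.MathematicalPhysics.QuantumFieldTheory.Balaban1983to89
open B4Sect5Proof (latticeConst latticeConst_nonneg)
open B6QGQLower276 (X e blk B mem_B sum_B_const AX lapKer sameBlk B_disjoint side)
open B6QGQDecay237 (deltaU deltaU_pos)
open B5Hk103ScalarZd (nbhd deltaH deltaH_pos tsum_AX_mul tsum_lapKer_mul lapKer_eq_zero_of_not_mem)
open Summit.QuantumFields.BalabanUV.Beta.D1BFx.BlockColumnSupNorm (cHs cHs_nonneg)
open Summit.QuantumFields.BalabanUV.Beta.D1BFx.PointColumnSplit (cKL cG0 cSplit)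
open Summit.QuantumFields.BalabanUV.Beta.D1BFx.PointColumnDecay (cFar)
open OneShotChartSupOperator (abs_apply_le_norm)
open FibreInverseSupNorm (abs_blockAvg_le)
open AugmentedSupEquivalence (exists_clm_blockAvg)
open SupSmallFieldBackground (exists_background)

variable {d : ℕ}

/-! ## §1. Blocks nest -/

section Nest

variable {m k n : ℕ}

/-- `n + 1 = (m+1)(k+1)` read on the integer sides. [folklore] -/
theorem side_mul (hn : n + 1 = (m + 1) * (k + 1)) : side n = side m * side k := by
  simp only [side]; exact_mod_cast hn

/-- **BLOCKS NEST**: the `(k+1)`-block label of the `(m+1)`-block label is the `(n+1)`-block label, `n + 1 = (m+1)(k+1)`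
(floor division by positive integers composes). [folklore] -/
theorem blk_blk (hn : n + 1 = (m + 1) * (k + 1)) (p : X d) : blk k (blk m p) = blk n p := by
  funext μ
  show p μ / side m / side k = p μ / side n
  rw [side_mul hn]
  exact Int.ediv_ediv_of_nonneg (by simp only [side]; positivity)

/-- The big block is the disjoint union of the small blocks over the intermediate block. [folklore] -/
theorem B_eq_biUnion (hn : n + 1 = (m + 1) * (k + 1)) (y : X d) : B n y = (B k y).biUnion (B m) := by
  classical
  ext p
  simp only [Finset.mem_biUnion, mem_B]
  constructor
  · intro h; exact ⟨blk m p, by rw [blk_blk hn, h], rfl⟩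
  · rintro ⟨z, hz, hp⟩; rw [← blk_blk hn, hp, hz]

/-- Sums over a big block are iterated sums. [folklore] -/
theorem sum_B_eq_sum_sum (hn : n + 1 = (m + 1) * (k + 1)) (f : X d → ℝ) (y : X d) :
    ∑ p ∈ B n y, f p = ∑ z ∈ B k y, ∑ p ∈ B m z, f p := by
  classical
  rw [B_eq_biUnion hn y, Finset.sum_biUnion]
  intro z _ z' _ hzz'
  exact B_disjoint hzz'

/-- `(n+1)^d = (m+1)^d (k+1)^d`. [folklore] -/
theorem cast_side_pow (hn : n + 1 = (m + 1) * (k + 1)) :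
    ((n : ℝ) + 1) ^ d = ((m : ℝ) + 1) ^ d * ((k : ℝ) + 1) ^ d := by
  rw [← mul_pow]; congr 1; exact_mod_cast hn

/-- **`Q′_k ∘ Q′_m = Q′_n` SITEWISE**: the `(k+1)`-block mean of the `(m+1)`-block means is the `(n+1)`-block mean. [folklore] -/
theorem blockAvg_blockAvg (hn : n + 1 = (m + 1) * (k + 1)) (f : X d → ℝ) (y : X d) :
    (((k : ℝ) + 1) ^ d)⁻¹ * ∑ z ∈ B k y, (((m : ℝ) + 1) ^ d)⁻¹ * ∑ p ∈ B m z, f p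
      = (((n : ℝ) + 1) ^ d)⁻¹ * ∑ p ∈ B n y, f p := by
  rw [sum_B_eq_sum_sum hn, cast_side_pow hn, ← Finset.mul_sum, mul_inv]
  ring

/-- The sum over a block of a block-constant field. [folklore] -/
theorem sum_B_comp_blk (m : ℕ) (F : X d → ℝ) (z : X d) :
    ∑ p ∈ B m z, F (blk m p) = ((m : ℝ) + 1) ^ d * F z := by
  rw [Finset.sum_congr rfl fun p (hp : p ∈ B m z) => by rw [mem_B.1 hp]]
  exact sum_B_const z (F z)

/-- The block mean of a block-constant field is its value. [folklore] -/
theorem blockAvg_comp_blk (m : ℕ) (F : X d → ℝ) (z : X d) :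
    (((m : ℝ) + 1) ^ d)⁻¹ * ∑ p ∈ B m z, F (blk m p) = F z := by
  have hs : (0 : ℝ) < ((m : ℝ) + 1) ^ d := by positivity
  rw [sum_B_comp_blk, ← mul_assoc, inv_mul_cancel₀ hs.ne', one_mul]

/-- **BLOCK-CONSTANCY DESCENDS**: a field equal to its `(n+1)`-block means is equal to its `(m+1)`-block means. [folklore] -/
theorem blockConst_descends (hn : n + 1 = (m + 1) * (k + 1)) {f : X d → ℝ}
    (hf : ∀ p, f p = (((n : ℝ) + 1) ^ d)⁻¹ * ∑ p' ∈ B n (blk n p), f p') (p : X d) :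
    f p = (((m : ℝ) + 1) ^ d)⁻¹ * ∑ p' ∈ B m (blk m p), f p' := by
  have hF : ∀ q, f q = (fun y => (((n : ℝ) + 1) ^ d)⁻¹ * ∑ p' ∈ B n y, f p') (blk k (blk m q)) := fun q => by
    rw [blk_blk hn]; exact hf q
  conv_rhs => rw [Finset.sum_congr rfl fun p' _ => hF p']
  rw [blockAvg_comp_blk m (fun z => (((n : ℝ) + 1) ^ d)⁻¹ * ∑ p' ∈ B n (blk k z), f p') (blk m p)]
  exact hF p

end Nest

/-! ## §2. The row formula of the site matrix -/

/-- **THE ROW FORMULA** of `A_n = Δ^η + aQ′*Q′` (every `d`, every `f : ℤ^d → ℝ`):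
`Σ_{r∈nbhd_n p} A_n(p,r)f(r) = (n+1)²·Σ_μ(2f(p) − f(p+e_μ) − f(p−e_μ)) + a(n+1)^{−d}·Σ_{q∈B_n(blk_n p)} f(q)`. [folklore] -/
theorem sum_nbhd_AX_mul (n : ℕ) (a : ℝ) (p : X d) (f : X d → ℝ) :
    ∑ r ∈ nbhd n p, AX n a p r * f r
      = ((n : ℝ) + 1) ^ 2 * ∑ μ, (2 * f p - f (p + e μ) - f (p - e μ))
        + a / ((n : ℝ) + 1) ^ d * ∑ q ∈ B n (blk n p), f q := by
  classical
  rw [← tsum_AX_mul]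
  have h1 : ∀ r, AX n a p r * f r
      = ((n : ℝ) + 1) ^ 2 * (lapKer p r * f r) + a / ((n : ℝ) + 1) ^ d * (sameBlk n p r * f r) := fun r => by
    simp only [AX]; ring
  have hS0 : ∀ r ∉ B n (blk n p), sameBlk n p r * f r = 0 := fun r hr => by
    rw [sameBlk, if_neg (fun h => hr (mem_B.2 h.symm)), zero_mul]
  have hsL : Summable fun r : X d => lapKer p r * f r :=
    summable_of_ne_finset_zero (s := nbhd n p) fun r hr => by rw [lapKer_eq_zero_of_not_mem hr, zero_mul]
  have hsS : Summable fun r : X d => sameBlk n p r * f r := summable_of_ne_finset_zero (s := B n (blk n p)) hS0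
  rw [tsum_congr h1, (hsL.mul_left _).tsum_add (hsS.mul_left _), tsum_mul_left, tsum_mul_left, tsum_lapKer_mul,
    tsum_eq_sum (s := B n (blk n p)) hS0]
  congr 2
  exact Finset.sum_congr rfl fun r hr => by rw [sameBlk, if_pos (mem_B.1 hr).symm, one_mul]

/-! ## §3. The background system descends with the rescaled potential -/

/-- **THE SIDE-`(n+1)` BACKGROUND SYSTEM IMPLIES THE SIDE-`(m+1)` SYSTEM FOR THE RESCALED POTENTIAL** (`n + 1 = (m+1)(k+1)`; sitewise,
any `a`, `u`, `φ`): if `A_nφ + u∘φ` equals its own `(n+1)`-block mean at every site, then `A_mφ + (k+1)⁻²·u∘φ` equals its own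
`(m+1)`-block mean at every site — because `A_mφ + (k+1)⁻²u∘φ = (k+1)⁻²(A_nφ + u∘φ) − (k+1)⁻²a·(Q′_nφ)∘blk_n + a·(Q′_mφ)∘blk_m` and
each term is `(m+1)`-block-constant. [folklore] -/
theorem background_eq_descends {m k n : ℕ} (hn : n + 1 = (m + 1) * (k + 1)) (a : ℝ) (u : ℝ → ℝ) (φ : X d → ℝ)
    (hEL : ∀ p : X d, (∑ r ∈ nbhd n p, AX n a p r * φ r) + u (φ p)
      = (((n : ℝ) + 1) ^ d)⁻¹ * ∑ p' ∈ B n (blk n p), ((∑ r ∈ nbhd n p', AX n a p' r * φ r) + u (φ p')))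
    (p : X d) :
    (∑ r ∈ nbhd m p, AX m a p r * φ r) + (((k : ℝ) + 1) ^ 2)⁻¹ * u (φ p)
      = (((m : ℝ) + 1) ^ d)⁻¹ * ∑ p' ∈ B m (blk m p),
          ((∑ r ∈ nbhd m p', AX m a p' r * φ r) + (((k : ℝ) + 1) ^ 2)⁻¹ * u (φ p')) := by
  have hsq : ((n : ℝ) + 1) ^ 2 = ((m : ℝ) + 1) ^ 2 * ((k : ℝ) + 1) ^ 2 := by
    rw [← mul_pow]; congr 1; exact_mod_cast hn
  have hk : (0 : ℝ) < ((k : ℝ) + 1) ^ 2 := by positivity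
  -- the side-`(m+1)` left side as a function of the small block label
  have key : ∃ F : X d → ℝ, ∀ q : X d,
      (∑ r ∈ nbhd m q, AX m a q r * φ r) + (((k : ℝ) + 1) ^ 2)⁻¹ * u (φ q) = F (blk m q) := by
    refine ⟨fun z : X d => (((k : ℝ) + 1) ^ 2)⁻¹
            * ((((n : ℝ) + 1) ^ d)⁻¹ * ∑ p' ∈ B n (blk k z), ((∑ r ∈ nbhd n p', AX n a p' r * φ r) + u (φ p'))
              - a / ((n : ℝ) + 1) ^ d * ∑ q' ∈ B n (blk k z), φ q')
          + a / ((m : ℝ) + 1) ^ d * ∑ q' ∈ B m z, φ q', fun q => ?_⟩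
    have hq := hEL q
    rw [sum_nbhd_AX_mul] at hq
    simp only [blk_blk hn]
    rw [sum_nbhd_AX_mul]
    have hL : ((m : ℝ) + 1) ^ 2 * ∑ μ, (2 * φ q - φ (q + e μ) - φ (q - e μ))
        = (((k : ℝ) + 1) ^ 2)⁻¹ * (((n : ℝ) + 1) ^ 2 * ∑ μ, (2 * φ q - φ (q + e μ) - φ (q - e μ))) := by
      rw [hsq, eq_inv_mul_iff_mul_eq₀ hk.ne']
      ring
    rw [hL]
    have hq' : ((n : ℝ) + 1) ^ 2 * ∑ μ, (2 * φ q - φ (q + e μ) - φ (q - e μ))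
        = (((n : ℝ) + 1) ^ d)⁻¹ * ∑ p' ∈ B n (blk n q), ((∑ r ∈ nbhd n p', AX n a p' r * φ r) + u (φ p'))
          - u (φ q) - a / ((n : ℝ) + 1) ^ d * ∑ q' ∈ B n (blk n q), φ q' := by linarith
    rw [hq']
    ring
  obtain ⟨F, hF⟩ := key
  rw [Finset.sum_congr rfl fun p' _ => hF p', blockAvg_comp_blk m F (blk m p)]
  exact hF p

/-! ## §4. The semigroup: (60) at the two sides -/

/-- **THE INTERACTING BACKGROUND IS A SEMIGROUP IN THE BLOCK SIDE** (`d ≥ 3`, `a > 0`, `n + 1 = (m+1)(k+1)`, (60)'s data: `u 0 = 0`,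
`|u′| ≤ λ`, `u′` `L`-Lipschitz, `N ≥ N_∞`, `2λ ≤ c < N⁻¹`, `r ≥ 0`).  There are (60)'s operators `Q′_n, A_n, P_n` and background `σ_n` at
side `n+1` for the potential `u` and radius `r`, with ALL of (60)'s letters; (60)'s operators `Q′_m, A_m, P_m` and background `σ_m` at
side `m+1` for the RESCALED potential `(k+1)⁻²·u` and radius `r∕(N⁻¹ − c)`, with ALL of (60)'s letters; and the block average `Q′_k`;
such that `Q′_k ∘ Q′_m = Q′_n`, and for `‖w‖ ≤ (N⁻¹ − c)·r`: `‖Q′_m(σ_n w)‖ ≤ r`, `Q′_k(Q′_m(σ_n w)) = w`, `σ_n w` solves the side-`(m+1)`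
system for `(k+1)⁻²u`, and **`σ_m(Q′_m(σ_n w)) = σ_n w`**; moreover the step branch `w ↦ Q′_m(σ_n w)` is `(N⁻¹ − c)⁻¹`-Lipschitz there.
[folklore] -/
theorem exists_background_semigroup (hd : 3 ≤ d) {m k n : ℕ} (hn : n + 1 = (m + 1) * (k + 1)) {a : ℝ} (ha : 0 < a)
    {u u' : ℝ → ℝ} (hu : ∀ t, HasDerivAt u (u' t) t) (hu0 : u 0 = 0) {lam c N : ℝ≥0} (hlam : ∀ t, |u' t| ≤ lam)
    {L : ℝ} (hL0 : 0 ≤ L) (hL : ∀ s t, |u' s - u' t| ≤ L * |s - t|)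
    (hN : cHs d a * latticeConst d (deltaH d a)
        + ((cG0 d * cKL d (d - 2) + cSplit d a) * Real.exp (2 * deltaU d a)
            + cFar d a * Real.exp (4 * deltaU d a) / deltaU d a ^ 2) * latticeConst d (deltaU d a / 4)
          * (1 + cHs d a * latticeConst d (deltaH d a)) ≤ (N : ℝ))
    (hc : 2 * lam ≤ c) (hcN : c < N⁻¹) {r : ℝ} (hr : 0 ≤ r) :
    ∃ (DopN AopN PopN : lp (fun _ : X d => ℝ) ∞ →L[ℝ] lp (fun _ : X d => ℝ) ∞)
      (σN : lp (fun _ : X d => ℝ) ∞ → lp (fun _ : X d => ℝ) ∞)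
      (DopM AopM PopM : lp (fun _ : X d => ℝ) ∞ →L[ℝ] lp (fun _ : X d => ℝ) ∞)
      (σM : lp (fun _ : X d => ℝ) ∞ → lp (fun _ : X d => ℝ) ∞)
      (DopK : lp (fun _ : X d => ℝ) ∞ →L[ℝ] lp (fun _ : X d => ℝ) ∞),
      -- side `n + 1`, potential `u`, radius `r`
      (∀ (f : lp (fun _ : X d => ℝ) ∞) (y : X d), DopN f y = (((n : ℝ) + 1) ^ d)⁻¹ * ∑ p ∈ B n y, f p) ∧
      (∀ (f : lp (fun _ : X d => ℝ) ∞) (p : X d), AopN f p = ∑ r ∈ nbhd n p, AX n a p r * f r) ∧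
      (∀ (f : lp (fun _ : X d => ℝ) ∞) (p : X d), PopN f p = f p - (((n : ℝ) + 1) ^ d)⁻¹ * ∑ p' ∈ B n (blk n p), f p') ∧
      σN 0 = 0 ∧
      (∀ w ∈ closedBall (0 : lp (fun _ : X d => ℝ) ∞) (((N : ℝ)⁻¹ - c) * r),
        σN w ∈ closedBall 0 r ∧ DopN (σN w) = w ∧
          ∀ p : X d, AopN (σN w) p + u (σN w p)
            = (((n : ℝ) + 1) ^ d)⁻¹ * ∑ p' ∈ B n (blk n p), (AopN (σN w) p' + u (σN w p'))) ∧
      LipschitzOnWith (N⁻¹ - c)⁻¹ σN (closedBall (0 : lp (fun _ : X d => ℝ) ∞) (((N : ℝ)⁻¹ - c) * r)) ∧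
      (∀ φ ∈ closedBall (0 : lp (fun _ : X d => ℝ) ∞) r,
        (∀ p : X d, AopN φ p + u (φ p) = (((n : ℝ) + 1) ^ d)⁻¹ * ∑ p' ∈ B n (blk n p), (AopN φ p' + u (φ p'))) →
          σN (DopN φ) = φ) ∧
      (∀ w ∈ ball (0 : lp (fun _ : X d => ℝ) ∞) (((N : ℝ)⁻¹ - c) * r),
        DifferentiableAt ℝ σN w ∧ ‖fderiv ℝ σN w‖ ≤ ((N : ℝ)⁻¹ - c)⁻¹ ∧
          DopN.comp (fderiv ℝ σN w) = ContinuousLinearMap.id ℝ (lp (fun _ : X d => ℝ) ∞)) ∧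
      -- side `m + 1`, potential `(k+1)⁻²·u`, radius `r / (N⁻¹ − c)`
      (∀ (f : lp (fun _ : X d => ℝ) ∞) (y : X d), DopM f y = (((m : ℝ) + 1) ^ d)⁻¹ * ∑ p ∈ B m y, f p) ∧
      (∀ (f : lp (fun _ : X d => ℝ) ∞) (p : X d), AopM f p = ∑ r ∈ nbhd m p, AX m a p r * f r) ∧
      (∀ (f : lp (fun _ : X d => ℝ) ∞) (p : X d), PopM f p = f p - (((m : ℝ) + 1) ^ d)⁻¹ * ∑ p' ∈ B m (blk m p), f p') ∧
      σM 0 = 0 ∧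
      (∀ w ∈ closedBall (0 : lp (fun _ : X d => ℝ) ∞) (((N : ℝ)⁻¹ - c) * (r / ((N : ℝ)⁻¹ - c))),
        σM w ∈ closedBall 0 (r / ((N : ℝ)⁻¹ - c)) ∧ DopM (σM w) = w ∧
          ∀ p : X d, AopM (σM w) p + (((k : ℝ) + 1) ^ 2)⁻¹ * u (σM w p)
            = (((m : ℝ) + 1) ^ d)⁻¹ * ∑ p' ∈ B m (blk m p),
                (AopM (σM w) p' + (((k : ℝ) + 1) ^ 2)⁻¹ * u (σM w p'))) ∧
      LipschitzOnWith (N⁻¹ - c)⁻¹ σM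
        (closedBall (0 : lp (fun _ : X d => ℝ) ∞) (((N : ℝ)⁻¹ - c) * (r / ((N : ℝ)⁻¹ - c)))) ∧
      (∀ φ ∈ closedBall (0 : lp (fun _ : X d => ℝ) ∞) (r / ((N : ℝ)⁻¹ - c)),
        (∀ p : X d, AopM φ p + (((k : ℝ) + 1) ^ 2)⁻¹ * u (φ p)
          = (((m : ℝ) + 1) ^ d)⁻¹ * ∑ p' ∈ B m (blk m p), (AopM φ p' + (((k : ℝ) + 1) ^ 2)⁻¹ * u (φ p'))) →
          σM (DopM φ) = φ) ∧
      (∀ w ∈ ball (0 : lp (fun _ : X d => ℝ) ∞) (((N : ℝ)⁻¹ - c) * (r / ((N : ℝ)⁻¹ - c))),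
        DifferentiableAt ℝ σM w ∧ ‖fderiv ℝ σM w‖ ≤ ((N : ℝ)⁻¹ - c)⁻¹ ∧
          DopM.comp (fderiv ℝ σM w) = ContinuousLinearMap.id ℝ (lp (fun _ : X d => ℝ) ∞)) ∧
      -- side `k + 1` block average and THE SEMIGROUP
      (∀ (f : lp (fun _ : X d => ℝ) ∞) (y : X d), DopK f y = (((k : ℝ) + 1) ^ d)⁻¹ * ∑ p ∈ B k y, f p) ∧
      DopK.comp DopM = DopN ∧
      (∀ w ∈ closedBall (0 : lp (fun _ : X d => ℝ) ∞) (((N : ℝ)⁻¹ - c) * r),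
        DopM (σN w) ∈ closedBall (0 : lp (fun _ : X d => ℝ) ∞) r ∧ DopK (DopM (σN w)) = w ∧
          (∀ p : X d, AopM (σN w) p + (((k : ℝ) + 1) ^ 2)⁻¹ * u (σN w p)
            = (((m : ℝ) + 1) ^ d)⁻¹ * ∑ p' ∈ B m (blk m p),
                (AopM (σN w) p' + (((k : ℝ) + 1) ^ 2)⁻¹ * u (σN w p'))) ∧
          σM (DopM (σN w)) = σN w) ∧
      LipschitzOnWith (N⁻¹ - c)⁻¹ (fun w => DopM (σN w))
        (closedBall (0 : lp (fun _ : X d => ℝ) ∞) (((N : ℝ)⁻¹ - c) * r)) := by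
  -- (60) at side `n + 1`
  obtain ⟨DopN, AopN, PopN, σN, hDN, hAN, hPN, hσN0, hσN, hlipN, huniqN, hderivN⟩ :=
    exists_background hd n ha hu hu0 hlam hL0 hL hN hc hcN hr
  -- the rescaled potential obeys the same letters
  have hk1 : (1 : ℝ) ≤ ((k : ℝ) + 1) ^ 2 := one_le_pow₀ (by linarith [(Nat.cast_nonneg k : (0 : ℝ) ≤ k)])
  have hkinv : (0 : ℝ) ≤ (((k : ℝ) + 1) ^ 2)⁻¹ := by positivity
  have hkinv1 : (((k : ℝ) + 1) ^ 2)⁻¹ ≤ 1 := inv_le_one_of_one_le₀ hk1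
  have huk : ∀ t, HasDerivAt (fun t => (((k : ℝ) + 1) ^ 2)⁻¹ * u t) ((((k : ℝ) + 1) ^ 2)⁻¹ * u' t) t :=
    fun t => (hu t).const_mul _
  have huk0 : (fun t => (((k : ℝ) + 1) ^ 2)⁻¹ * u t) 0 = 0 := by simp only [hu0, mul_zero]
  have hlamk : ∀ t, |(((k : ℝ) + 1) ^ 2)⁻¹ * u' t| ≤ lam := fun t => by
    rw [abs_mul, abs_of_nonneg hkinv]
    exact (mul_le_of_le_one_left (abs_nonneg _) hkinv1).trans (hlam t)
  have hLk : ∀ s t, |(((k : ℝ) + 1) ^ 2)⁻¹ * u' s - (((k : ℝ) + 1) ^ 2)⁻¹ * u' t| ≤ L * |s - t| := fun s t => by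
    rw [← mul_sub, abs_mul, abs_of_nonneg hkinv]
    exact (mul_le_of_le_one_left (abs_nonneg _) hkinv1).trans (hL s t)
  have hK : (0 : ℝ) < (N : ℝ)⁻¹ - c := by
    have h := NNReal.coe_lt_coe.2 hcN
    rw [NNReal.coe_inv] at h
    exact sub_pos.2 h
  -- `N ≥ C_∞ ≥ 1`, so the chart ball factor is at most one
  have hK1 : (N : ℝ)⁻¹ - c ≤ 1 := by
    have hCH1 : 1 ≤ cHs d a * latticeConst d (deltaH d a) := OneShotChartSupNorm.one_le_supConst hd n ha
    have hCΓ0 : 0 ≤ ((cG0 d * cKL d (d - 2) + cSplit d a) * Real.exp (2 * deltaU d a)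
        + cFar d a * Real.exp (4 * deltaU d a) / deltaU d a ^ 2) * latticeConst d (deltaU d a / 4)
          * (1 + cHs d a * latticeConst d (deltaH d a)) :=
      mul_nonneg (mul_nonneg (BlockPropagatorSupNorm.supConstG_nonneg d ha)
        (latticeConst_nonneg d (div_nonneg (deltaU_pos d ha).le zero_le_four))) (by linarith)
    have hN1 : (1 : ℝ) ≤ N := by linarith
    have h1 : (N : ℝ)⁻¹ ≤ 1 := inv_le_one_of_one_le₀ hN1
    linarith [NNReal.coe_nonneg c]
  have hr' : 0 ≤ r / ((N : ℝ)⁻¹ - c) := div_nonneg hr hK.le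
  have hrr' : r ≤ r / ((N : ℝ)⁻¹ - c) := by
    rw [le_div_iff₀ hK]; exact mul_le_of_le_one_right hr hK1
  -- (60) at side `m + 1` for the rescaled potential, radius `r / (N⁻¹ − c)`
  obtain ⟨DopM, AopM, PopM, σM, hDM, hAM, hPM, hσM0, hσM, hlipM, huniqM, hderivM⟩ :=
    exists_background hd m ha huk huk0 hlamk hL0 hLk hN hc hcN hr'
  obtain ⟨DopK, hDK, -⟩ := exists_clm_blockAvg (d := d) k
  have hKM : DopK.comp DopM = DopN :=
    ContinuousLinearMap.ext fun f => lp.ext (funext fun y => by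
      rw [ContinuousLinearMap.comp_apply, hDK, Finset.sum_congr rfl fun z _ => hDM f z, hDN]
      exact blockAvg_blockAvg hn (fun p => f p) y)
  have hDMn : ∀ f : lp (fun _ : X d => ℝ) ∞, ‖DopM f‖ ≤ ‖f‖ := fun f =>
    lp.norm_le_of_forall_le (norm_nonneg f) fun y => by
      rw [Real.norm_eq_abs, hDM]; exact abs_blockAvg_le m (abs_apply_le_norm f) y
  -- the four letters of the step branch
  have hstep : ∀ w ∈ closedBall (0 : lp (fun _ : X d => ℝ) ∞) (((N : ℝ)⁻¹ - c) * r),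
      DopM (σN w) ∈ closedBall (0 : lp (fun _ : X d => ℝ) ∞) r ∧ DopK (DopM (σN w)) = w ∧
        (∀ p : X d, AopM (σN w) p + (((k : ℝ) + 1) ^ 2)⁻¹ * u (σN w p)
          = (((m : ℝ) + 1) ^ d)⁻¹ * ∑ p' ∈ B m (blk m p),
              (AopM (σN w) p' + (((k : ℝ) + 1) ^ 2)⁻¹ * u (σN w p'))) ∧
        σM (DopM (σN w)) = σN w := by
    intro w hw
    obtain ⟨hball, hDw, hEL⟩ := hσN w hw
    rw [mem_closedBall, dist_zero_right] at hball
    have hELm : ∀ p : X d, AopM (σN w) p + (((k : ℝ) + 1) ^ 2)⁻¹ * u (σN w p)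
        = (((m : ℝ) + 1) ^ d)⁻¹ * ∑ p' ∈ B m (blk m p),
            (AopM (σN w) p' + (((k : ℝ) + 1) ^ 2)⁻¹ * u (σN w p')) := fun p => by
      simp only [hAM]
      refine background_eq_descends hn a u (fun q => σN w q) (fun q => ?_) p
      have h := hEL q
      simp only [hAN] at h
      exact h
    refine ⟨?_, ?_, hELm, huniqM (σN w) ?_ hELm⟩
    · rw [mem_closedBall, dist_zero_right]; exact (hDMn _).trans hball
    · rw [← ContinuousLinearMap.comp_apply, hKM, hDw]
    · rw [mem_closedBall, dist_zero_right]; exact hball.trans hrr'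
  have hlipstep : LipschitzOnWith (N⁻¹ - c)⁻¹ (fun w => DopM (σN w))
      (closedBall (0 : lp (fun _ : X d => ℝ) ∞) (((N : ℝ)⁻¹ - c) * r)) :=
    LipschitzOnWith.of_dist_le_mul fun x hx y hy => by
      rw [dist_eq_norm, ← map_sub]
      exact (hDMn _).trans (by rw [← dist_eq_norm]; exact hlipN.dist_le_mul x hx y hy)
  exact ⟨DopN, AopN, PopN, σN, DopM, AopM, PopM, σM, DopK, hDN, hAN, hPN, hσN0, hσN, hlipN, huniqN, hderivN,
    hDM, hAM, hPM, hσM0, hσM, hlipM, huniqM, hderivM, hDK, hKM, hstep, hlipstep⟩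

/-! ## §5. Toy -/

/-- Toy: sides `2·2 = 4` (`m = k = 1`, `n = 3`) and the canonical rescaling factor `(k+1)⁻² = 1∕4` of the potential per step. -/
example : (3 : ℕ) + 1 = (1 + 1) * (1 + 1) ∧ (((1 : ℝ) + 1) ^ 2)⁻¹ = 1 / 4 := by norm_num

end Summit.QuantumFields.BalabanUV.T4Continuum.NE7b.SupBackgroundSemigroup

end
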